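import Summits.Parity.GeneralizedHardyLittlewood.Theorems.BeyondDiagonalBeatsQuarter.OffDiagDualCompletionInt
import Summits.Parity.GeneralizedHardyLittlewood.Theorems.BeyondDiagonalBeatsQuarter.OffDiagLevelAP
import HarnessLib

/-!
# Route `PrimeLevelFamEdge`, crux K_B (stmt-Parity-20343), line `diagonal_kernel_split` rev 4, plan Ω,
# sub-line **Ω-e (OMEGA-BLUEPRINT L6′, a8P) — the PRINCIPAL BLOCK TERM of one dual modulus `h₁`:
# it is supported on the short moduli `|h₁| <` box height, and there it is an explicit lattice-sample sum**

Setting (G2 §(a) a8 after the divisor switch `OffDiagDivisorSwitch(Series)` and the class split `OffDiagLevelAP`): a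
finite set `G` of levels `q` (the good primes of a block), for each level a box weight `Φ_q : ℝ → ℝ → ℂ` (Ω-d5 `boxWeight`,
which depends on `q`), a Petersson index `c ≥ 1`, the product `ab` of the two Kloosterman frequencies, and a signed dual
modulus `h₁ ≠ 0`. For fixed `(h₁, s)` the levels run over an arithmetic progression mod `|h₁|`; replacing its indicator by
the density `1/φ(|h₁|)` over the levels coprime to `h₁` (`levelPrincipal`) and summing over ALL `s ∈ ℤ` gives the
**principal block term**
`P(h₁) = φ(|h₁|)⁻¹ · Σ_{q ∈ G, (q,h₁)=1} Σ_{s∈ℤ} Φ̂_q(h₁/(qc), s/h₁ + ab/(h₁·qc))`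
(written inline below; the second frequency is `h₂/(qc)` with `h₂ = (ab + qcs)/h₁`). By the completion lemmas
(`tsum_fourier2_intShift_eq(_zero)`, Poisson backwards in the second variable):

* **`principalBlock_eq_zero_of_height_le`** — if every `Φ_q` lives on heights `0 < t₂ < B` and `B ≤ |h₁|`, then `P(h₁) = 0`:
  the principal part of the dual term is carried by the SHORT moduli `0 < |h₁| < B` only (for the dyadic box `i`,
  `B = 2^{i₂+1}`); G1 §4 (v) «complete `s`-sums vanish» / G2 a8P;
* **`principalBlock_eq_latticeSamples`** — in general
  `P(h₁) = φ(|h₁|)⁻¹·|h₁|·Σ_{q} Σ_{k∈ℤ} e(−ab·k/(qc))·𝓕(t₁ ↦ Φ_q(t₁, |h₁|k))(h₁/(qc))` (the phase `e(−τ|h₁|k)` with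
  `τ = ab/(h₁qc)` simplifies to `e(∓ab·k/(qc))`, stated with `τ` kept symbolic).

Finite sums of landed series identities; theorems only (the principal block term is written inline, no definition);
standard axioms. Helper toward `stub_offDiagBelowSlack_io`; closes nothing — whether the short-modulus samples total
`o(ms)` against the mollifier (C2) is the open content of L6.
«The programme SEARCHES and TYPES; no claim about Landau–Siegel zeros, Theorems 1–2 of arXiv:2211.02515 or
a repaired Margin232 until a kernel theorem says so.»
-/

noncomputable section

open Real MeasureTheory Filter Complex Finset
open scoped FourierTransform Topology ContDiff

namespace Summit.Parity.GeneralizedHardyLittlewood.Theorems.BeyondDiagonalBeatsQuarter.OffDiag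

open Literature.NumberTheory.Sieve.FriedlanderIwaniecPrimes (fourier2)

/-- **The principal block term vanishes for moduli beyond the box height.** For a finite set of levels `G`, box
weights `Φ_q` (smooth, compact support) all living on heights `0 < t₂ < B`, `c ≥ 1`, and a signed modulus `h₁` with
`B ≤ |h₁|`: `Σ_{q ∈ G'} Σ_{s∈ℤ} Φ̂_q(h₁/(qc), s/h₁ + τ_q) = 0` for ANY sub-family `G' ⊆ G` and ANY shifts `τ_q` — hence the
principal block term `φ(|h₁|)⁻¹·(that sum)` is `0`. [folklore] -/
theorem principalBlock_eq_zero_of_height_le (G : Finset ℕ) (Φ : ℕ → ℝ → ℝ → ℂ)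
    (hΦ : ∀ q ∈ G, ContDiff ℝ ∞ (Function.uncurry (Φ q)))
    (hΦc : ∀ q ∈ G, HasCompactSupport (Function.uncurry (Φ q))) {B : ℝ}
    (hsupp : ∀ q ∈ G, ∀ t₁ t₂, Φ q t₁ t₂ ≠ 0 → 0 < t₂ ∧ t₂ < B)
    {h₁ : ℤ} (hh : h₁ ≠ 0) (hB : B ≤ (h₁.natAbs : ℝ)) (ξ₁ τ : ℕ → ℝ) (w : ℂ) :
    w * ∑ q ∈ G, ∑' s : ℤ, fourier2 (Φ q) (ξ₁ q) ((s : ℝ) / h₁ + τ q) = 0 := by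
  rw [Finset.sum_eq_zero fun q hq ↦ tsum_fourier2_intShift_eq_zero (hΦ q hq) (hΦc q hq) (hsupp q hq) hh hB
    (τ q) (ξ₁ q), mul_zero]

/-- **The principal block term as lattice samples.** For a finite set of levels `G`, box weights `Φ_q` (smooth, compact
support), `h₁ ≠ 0`, frequencies `ξ₁ q` and shifts `τ q`:
`Σ_{q∈G} Σ_{s∈ℤ} Φ̂_q(ξ₁ q, s/h₁ + τ q) = |h₁|·Σ_{q∈G} Σ_{k∈ℤ} e(−τ_q|h₁|k)·𝓕(t₁ ↦ Φ_q(t₁, |h₁|k))(ξ₁ q)`. [folklore] -/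
theorem principalBlock_eq_latticeSamples (G : Finset ℕ) (Φ : ℕ → ℝ → ℝ → ℂ)
    (hΦ : ∀ q ∈ G, ContDiff ℝ ∞ (Function.uncurry (Φ q)))
    (hΦc : ∀ q ∈ G, HasCompactSupport (Function.uncurry (Φ q)))
    {h₁ : ℤ} (hh : h₁ ≠ 0) (ξ₁ τ : ℕ → ℝ) :
    ∑ q ∈ G, ∑' s : ℤ, fourier2 (Φ q) (ξ₁ q) ((s : ℝ) / h₁ + τ q) =
      (h₁.natAbs : ℂ) * ∑ q ∈ G, ∑' k : ℤ, (𝐞 (-(τ q * (h₁.natAbs * k))) : ℂ) *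
        𝓕 (fun t₁ : ℝ ↦ Φ q t₁ (h₁.natAbs * k)) (ξ₁ q) := by
  rw [Finset.mul_sum]
  exact Finset.sum_congr rfl fun q hq ↦ tsum_fourier2_intShift_eq (hΦ q hq) (hΦc q hq) hh (τ q) (ξ₁ q)

/-- **The principal part in `levelPrincipal` form.** For fixed `(h₁, s)` let `F_s q = Φ̂_q(ξ₁ q, s/h₁ + τ q)`; then the sum
over `s` of the principal parts `levelPrincipal G F_s n` (any modulus bookkeeping `n`, density `φ(n)⁻¹`) is
`φ(n)⁻¹ · Σ_{q ∈ G, q unit mod n} Σ_s Φ̂_q(…)`, which VANISHES when the boxes live below height `|h₁|` — i.e. the principal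
block term of a8P is carried by `0 < |h₁| < B` only. (Exchange of the finite level sum with the `s`-series requires each
`s`-series to be summable: hypothesis `hsum`.) [folklore] -/
theorem tsum_levelPrincipal_eq_zero_of_height_le (G : Finset ℕ) (Φ : ℕ → ℝ → ℝ → ℂ)
    (hΦ : ∀ q ∈ G, ContDiff ℝ ∞ (Function.uncurry (Φ q)))
    (hΦc : ∀ q ∈ G, HasCompactSupport (Function.uncurry (Φ q))) {B : ℝ}
    (hsupp : ∀ q ∈ G, ∀ t₁ t₂, Φ q t₁ t₂ ≠ 0 → 0 < t₂ ∧ t₂ < B)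
    {h₁ : ℤ} (hh : h₁ ≠ 0) (hB : B ≤ (h₁.natAbs : ℝ)) (ξ₁ τ : ℕ → ℝ) (n : ℕ)
    (hsum : ∀ q ∈ G, Summable fun s : ℤ ↦ fourier2 (Φ q) (ξ₁ q) ((s : ℝ) / h₁ + τ q)) :
    ∑' s : ℤ, levelPrincipal G (fun q ↦ fourier2 (Φ q) (ξ₁ q) ((s : ℝ) / h₁ + τ q)) n = 0 := by
  classical
  simp only [levelPrincipal, levelCoprimeSum]
  rw [tsum_mul_left]
  have hG' : ∀ q ∈ G.filter (fun q : ℕ ↦ IsUnit ((q : ℕ) : ZMod n)), q ∈ G := fun q hq ↦ (Finset.mem_filter.mp hq).1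
  rw [Summable.tsum_finsetSum (fun q hq ↦ hsum q (hG' q hq))]
  have h0 := principalBlock_eq_zero_of_height_le (G.filter (fun q : ℕ ↦ IsUnit ((q : ℕ) : ZMod n))) Φ
    (fun q hq ↦ hΦ q (hG' q hq)) (fun q hq ↦ hΦc q (hG' q hq)) (fun q hq ↦ hsupp q (hG' q hq)) hh hB ξ₁ τ 1
  rw [one_mul] at h0
  rw [h0, mul_zero]

end Summit.Parity.GeneralizedHardyLittlewood.Theorems.BeyondDiagonalBeatsQuarter.OffDiag
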